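import Summits.ResolutionOfSingularities.ResolutionOfSingularities.Theses.MaxContactCut
import Summits.ResolutionOfSingularities.ResolutionOfSingularities.Theorems.PlanarGhostDescent
import HarnessLib

/-!
# MaxContactCutPlanarClosed — the route aside 28121 `MaxContactCut.CFNoMonomialLedPlanarJointTailsDeep` is PROVED
# (decomp-res node «GhostDescent», lens-5 g27, critic row 183 CLEARED DECIDED +1)

ITEM CLOSURE (critic rider INBOX :931 (B) — the first decomp-res aside to close PROVED).  The Theses aside
`Summit.ResolutionOfSingularities.ResolutionOfSingularities.Theses.MaxContactCut.CFNoMonomialLedPlanarJointTailsDeep`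
(item `stmt-ResolutionOfSingularities-28121`, filed by the writer g5 on the lens-5 PLANAR column of 31770
`MaxContactCut.DefectWalksDeep`) is BY DEFINITION `CoefficientCut.NoMonomialLedPlanarJointTailsDeep`, and that class is now a
THEOREM of the tree: `GhostDescent.noMonomialLedPlanarJointTailsDeep_holds` (`Theorems/PlanarGhostDescent.lean`, landed from the
lens-5 g27 node `HOME/decomp-res-lens-5/g27/PlanarGhostDescent.lean` pin 53b88513 — the ghost descent of the wall layer `0` along
forced planar walks: order window from `W.isolated`, `fat_of_heavy_layer_zero`, `not_isolatedTop_of_fat`, (M)/(P) on layer `0`,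
halving at repeats, `layer_zero_not_monomialLed`; port-free, hypothesis-free, every field, `q = pᵉ`, `e ≥ 2`).  This 3-line file
sits above both the route file and the theorem (no import cycle) and is proposed `--kind proof --workitem
stmt-ResolutionOfSingularities-28121` so that the gate closes the item `proved`.  Consequence for the column bookkeeping (TREE.md):
MaxContactCut PLANAR COLUMN CLOSED; node equation `GhostDescent.defectWalksDeep_iff_skew : DefectWalksDeep ↔ NoSkewJointTailsDeep`;
lens-5 keeps exactly its filed skew aside(s) — no new aside, no switch.

(Sources: Hauser2010Kangaroo §F; HauserPerlega2019; HauserPerlega2024; Moh1987; CossartJannsenSaito2020 Ch. 6.)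
-/

namespace Summit.ResolutionOfSingularities.ResolutionOfSingularities.Theorems.GhostDescent

/-- **THE ROUTE ASIDE 28121 IS A THEOREM**: `MaxContactCut.CFNoMonomialLedPlanarJointTailsDeep` (:= `CoefficientCut.NoMonomialLedPlanarJointTailsDeep`)
holds, by `GhostDescent.noMonomialLedPlanarJointTailsDeep_holds` (decomp-res lens-5 g27 «GhostDescent», critic row 183). [new] -/
theorem cfNoMonomialLedPlanarJointTailsDeep_proved :
    Summit.ResolutionOfSingularities.ResolutionOfSingularities.Theses.MaxContactCut.CFNoMonomialLedPlanarJointTailsDeep :=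
  noMonomialLedPlanarJointTailsDeep_holds

end Summit.ResolutionOfSingularities.ResolutionOfSingularities.Theorems.GhostDescent
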